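import Summits.AtomisticToContinuum.BoseEinsteinCondensation.Theorems.BECSwapNoCatastropheTorusHalfSwapOverlapAbsHardLayerPBasics
import Literature.MathematicalPhysics.QuantumManyBody.BoseGasHardLayerDecay
import HarnessLib

/-!
# The mass of a finite-energy function in the pair-profile hard layers is `o(s²)` (stub Z of the H chain)

Route `BECSwapNoCatastrophe`, crux `TorusHalfSwapOverlap` (stmt-AtomisticToContinuum-14393), line `registered`,
skeleton v8 (truncation split; the hard-core maximal-form bound H on the absolute, symmetry-free class for
PAIR-DEPENDENT profiles `V i j`). This file is the pair-profile twin of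
`Literature/MathematicalPhysics/QuantumManyBody/BoseGasHardLayerDecay.lean` under the dictionary
`hardRad v ↦ hardRad (V i j)` (per pair), `hardLayer v L s ↦ hardLayerP V L s`, `hardZone ↦ hardZoneP`,
`periodicInteraction v L ↦ pairInteraction V L`; Bose symmetry of states plays no role. The two analytic inputs of
the one-copy file — the integrated Hardy bound on the `LayerA` pieces (`setLIntegral_layerA_le`) and the a.e.
vanishing on the hard configurations (`ae_eq_zero_of_mem_hardLayer_zero`) — enter as the written-out HYPOTHESES of
the registered statement (they are the neighbouring stubs Y and X of the skeleton):

* `decayP_exists_notMem_hardZoneP` / `decayP_iInter_preimage_hardZoneP_eq_empty` — the transition zones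
  `hardZoneP V L (1/(m+1))` shrink to nothing (hard radii bounded by `R₀`; a zone point names a pair WITH hard
  radii, so no global nonemptiness hypothesis is needed);
* `decayP_tendsto_zoneEnergy` — hence the directional energy in the transition zone tends to `0`;
* `decayP_preimage_hardLayerP_subset` — the hard layer of width `s` is covered by the hard configurations
  `hardLayerP V L 0`, the dyadic pieces `LayerA(s/3^{j+1})` and the near-coincidence sets
  `{some pair-image radius < 40 s/3^{j+1}}`;
* `stub_hardLayerPDecay` — **for every `ε > 0` there is `s₀ > 0` with
  `∫_{fromUnitTorusN L ⁻¹' hardLayerP V L s} |η|² ≤ ε s²` for all `0 < s ≤ s₀`.**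

Tagged folklore ([LSSY2005] Ch. 2 (2.1): hard cores in the standing class of interactions).
-/

noncomputable section

namespace Summit.AtomisticToContinuum.BoseEinsteinCondensation.Cruxes.TorusHalfSwapOverlap.TruncationSplit

open MeasureTheory Filter Topology Set Metric
open scoped ENNReal NNReal
open Literature.MathematicalPhysics.QuantumManyBody.BoseGas
open Literature.MathematicalPhysics.QuantumManyBody.BoseGas.HardLayerAux
open Summit.AtomisticToContinuum.BoseEinsteinCondensation.AbsTorus

-- The measure on `ℝ/ℤ` is the Haar PROBABILITY measure, as in `PeriodicFormDomain.lean`.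
attribute [local instance] formDomain_measureSpace formDomain_isProbabilityMeasure formDomain_isProbabilityMeasure_pi

variable {N : ℕ} {L : ℝ} {V : Fin N → Fin N → ℝ → ℝ≥0∞}

/-- **The pair-profile transition zones shrink to nothing**: every configuration lies outside `hardZoneP V L s`
for some `s > 0` (hard radii of all pair profiles bounded by `R₀`; a zone point names a pair with hard radii, so
no global nonemptiness is needed). [folklore] -/
theorem decayP_exists_notMem_hardZoneP (hL : 0 < L) {R₀ : ℝ} (hSR : ∀ i j, ∀ b ∈ hardRad (V i j), b ≤ R₀)
    (X : Config N) : ∃ s : ℝ, 0 < s ∧ X ∉ hardZoneP V L s := by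
  classical
  -- the finitely many positive distances of relevant image pairs
  set P : Set ℝ := (fun p : (Fin N × Fin N) × (Fin 3 → ℤ) =>
      infDist (pairRad L X p.1.1 p.1.2 p.2) (hardRad (V p.1.1 p.1.2))) ''
    ({p | pairRad L X p.1.1 p.1.2 p.2 ≤ R₀ + 3} ∩
      {p | 0 < infDist (pairRad L X p.1.1 p.1.2 p.2) (hardRad (V p.1.1 p.1.2))}) with hP
  have hPfin : P.Finite := ((finite_pairRad_le hL X (R₀ + 3)).subset inter_subset_left).image _
  have hPpos : ∀ d ∈ P, 0 < d := by
    rintro d ⟨p, hp, rfl⟩; exact hp.2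
  -- a positive lower bound of `P ∪ {3}`
  obtain ⟨δ, hδ, hδP⟩ : ∃ δ : ℝ, 0 < δ ∧ δ ≤ 3 ∧ ∀ d ∈ P, δ ≤ d := by
    rcases P.eq_empty_or_nonempty with h | h
    · exact ⟨3, by norm_num, le_rfl, fun d hd => by rw [h] at hd; exact hd.elim⟩
    · refine ⟨min 3 (hPfin.toFinset.min' (by simpa using h)), lt_min (by norm_num) ?_, min_le_left _ _,
        fun d hd => ?_⟩
      · exact hPpos _ (by simpa using hPfin.toFinset.min'_mem (by simpa using h))
      · exact (min_le_right _ _).trans (hPfin.toFinset.min'_le d (by simpa using hd))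
  refine ⟨δ / 4, by positivity, ?_⟩
  rintro ⟨i, j, n, -, hne, hpos, hle⟩
  -- the witnessing pair is relevant, so its distance is at least `δ`
  have hrad : pairRad L X i j n ≤ R₀ + 3 := by
    obtain ⟨b, hb⟩ := hne
    have h1 : infDist (pairRad L X i j n) (hardRad (V i j)) ≤ 3 * (δ / 4) := hle
    have h2 : pairRad L X i j n - R₀ ≤ infDist (pairRad L X i j n) (hardRad (V i j)) := by
      refine (le_infDist ⟨b, hb⟩).2 fun c hc => ?_
      rw [Real.dist_eq]
      have := hSR i j c hc
      calc pairRad L X i j n - R₀ ≤ pairRad L X i j n - c := by linarith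
        _ ≤ |pairRad L X i j n - c| := le_abs_self _
    linarith
  have hmem : infDist (pairRad L X i j n) (hardRad (V i j)) ∈ P := ⟨((i, j), n), ⟨hrad, hpos⟩, rfl⟩
  have := hδP.2 _ hmem
  linarith [hδP.1]

/-- The pulled-back pair-profile transition zones of widths `1/(m+1)` have empty intersection. [folklore] -/
theorem decayP_iInter_preimage_hardZoneP_eq_empty (hL : 0 < L) {R₀ : ℝ}
    (hSR : ∀ i j, ∀ b ∈ hardRad (V i j), b ≤ R₀) :
    ⋂ m : ℕ, fromUnitTorusN L ⁻¹' hardZoneP V L (1 / ((m : ℝ) + 1)) =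
      (∅ : Set (UnitAddTorus (Fin N × Fin 3))) := by
  refine eq_empty_iff_forall_notMem.2 fun t ht => ?_
  rw [mem_iInter] at ht
  obtain ⟨s, hs, hX⟩ := decayP_exists_notMem_hardZoneP hL hSR (fromUnitTorusN L t)
  obtain ⟨m, hm⟩ := exists_nat_one_div_lt hs
  exact hX (hardZoneP_mono V L hm.le (ht m))

/-- **The directional energy in the pair-profile transition zone tends to zero** along the widths `1/(m+1)`.
[folklore] -/
theorem decayP_tendsto_zoneEnergy (hL : 0 < L) {R₀ : ℝ} (hSR : ∀ i j, ∀ b ∈ hardRad (V i j), b ≤ R₀)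
    {F : UnitAddTorus (Fin N × Fin 3) → ℝ≥0∞} (hF : ∫⁻ t, F t ≠ ⊤) :
    Tendsto (fun m : ℕ => ∫⁻ t in fromUnitTorusN L ⁻¹' hardZoneP V L (1 / ((m : ℝ) + 1)), F t) atTop (𝓝 0) := by
  set μ : Measure (UnitAddTorus (Fin N × Fin 3)) := volume.withDensity F with hμ
  have hmeas : ∀ m : ℕ, MeasurableSet (fromUnitTorusN L ⁻¹' hardZoneP V L (1 / ((m : ℝ) + 1))) :=
    fun m => (measurableSet_hardZoneP V L _).preimage (measurable_fromUnitTorusN L)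
  have heq : ∀ m : ℕ, ∫⁻ t in fromUnitTorusN L ⁻¹' hardZoneP V L (1 / ((m : ℝ) + 1)), F t =
      μ (fromUnitTorusN L ⁻¹' hardZoneP V L (1 / ((m : ℝ) + 1))) := fun m =>
    (withDensity_apply F (hmeas m)).symm
  simp only [heq]
  have h := tendsto_measure_iInter_atTop (μ := μ)
    (s := fun m : ℕ => fromUnitTorusN L ⁻¹' hardZoneP V L (1 / ((m : ℝ) + 1)))
    (fun m => (hmeas m).nullMeasurableSet) (fun m m' hmm' => preimage_mono (hardZoneP_mono V L
      (one_div_le_one_div_of_le (by positivity) (by exact_mod_cast Nat.succ_le_succ hmm'))))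
    ⟨0, by rw [withDensity_apply F (hmeas 0)]; exact ne_top_of_le_ne_top hF (setLIntegral_le_lintegral _ _)⟩
  rwa [decayP_iInter_preimage_hardZoneP_eq_empty hL hSR, measure_empty] at h

/-- **The pair-profile hard layer is covered by the hard configurations, the dyadic `LayerA` pieces and the
near-coincidences.** For `s > 0`: a configuration with an image pair (of a pair with hard radii) within `s` of a
hard radius of its profile is either ON a hard sphere, or the distance `d` lies in `(s/3^{j+1}, s/3^j]` for some
`j`, and then the pair has radius `≥ 40 s/3^{j+1}` (a `LayerA(s/3^{j+1})` configuration) or `< 40 s/3^{j+1}`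
(a near-coincidence). [folklore] -/
theorem decayP_preimage_hardLayerP_subset (V : Fin N → Fin N → ℝ → ℝ≥0∞) (L : ℝ) {s : ℝ} (hs : 0 < s) :
    fromUnitTorusN L ⁻¹' hardLayerP V L s ⊆
      fromUnitTorusN L ⁻¹' hardLayerP V L 0 ∪
      ⋃ j : ℕ, ({t : UnitAddTorus (Fin N × Fin 3) | ∃ (i j' : Fin N) (n : Fin 3 → ℤ), i ≠ j' ∧
          (hardRad (V i j')).Nonempty ∧
          0 < Metric.infDist (pairRad L (fromUnitTorusN L t) i j' n) (hardRad (V i j')) ∧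
          Metric.infDist (pairRad L (fromUnitTorusN L t) i j' n) (hardRad (V i j')) ≤ 3 * (s / 3 ^ (j + 1)) ∧
          40 * (s / 3 ^ (j + 1)) ≤ pairRad L (fromUnitTorusN L t) i j' n} ∪
        {t : UnitAddTorus (Fin N × Fin 3) | ∃ (i j' : Fin N) (n : Fin 3 → ℤ), i ≠ j' ∧
          pairRad L (fromUnitTorusN L t) i j' n < 40 * (s / 3 ^ (j + 1))}) := by
  rintro t ⟨i, j', n, hij, hne, hle⟩
  by_cases h0 : infDist (pairRad L (fromUnitTorusN L t) i j' n) (hardRad (V i j')) ≤ 0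
  · exact Or.inl ⟨i, j', n, hij, hne, h0⟩
  push Not at h0
  set d : ℝ := infDist (pairRad L (fromUnitTorusN L t) i j' n) (hardRad (V i j')) with hd
  obtain ⟨m, hm1, -⟩ := exists_nat_pow_near (x := s / d) ((one_le_div h0).2 hle) (y := 3) (by norm_num)
  refine Or.inr (mem_iUnion.2 ⟨m, ?_⟩)
  have h3 : d ≤ 3 * (s / 3 ^ (m + 1)) := by
    rw [show 3 * (s / 3 ^ (m + 1)) = s / 3 ^ m by rw [pow_succ]; field_simp]
    rw [le_div_iff₀ (by positivity)]
    have := (le_div_iff₀ h0).1 hm1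
    linarith
  by_cases hrad : 40 * (s / 3 ^ (m + 1)) ≤ pairRad L (fromUnitTorusN L t) i j' n
  · exact Or.inl ⟨i, j', n, hij, hne, h0, h3, hrad⟩
  · exact Or.inr ⟨i, j', n, hij, not_le.1 hrad⟩

/-- **The mass in the pair-profile hard layers is `o(s²)`** (stub Z of the H chain; twin of
`exists_setLIntegral_hardLayer_le`). Assume the integrated Hardy bound on the pair-profile `LayerA` pieces (first
binder, stub Y) and the a.e. vanishing of finite-energy functions on the pair-profile hard configurations (second
binder, stub X). Let the profiles `V i j = V j i` be measurable with hard radii bounded by `R₀`, `L > 0`, and `η` a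
function on `(ℝ/ℤ)^{3N}` bounded by `k` a.e. such that for every coordinate `q` there are `G_q = η` a.e. and a
measurable square-integrable `H_q` with, for a.e. `t`, the ACL property of `G_q` along the `q`-line through `t`
(derivative `H_q`) and locally finite line potential energy for `W_V = pairInteraction V L`. Then for every `ε > 0`
there is `s₀ > 0` such that `∫_{fromUnitTorusN L ⁻¹' hardLayerP V L s} |η|² ≤ ε s²` for all `0 < s ≤ s₀`: the zone
energy tends to `0` (`decayP_tendsto_zoneEnergy`), the layer is covered by the hard configurations (no mass, by X),
the dyadic `LayerA` pieces (Hardy, by Y) and the near-coincidences (pair volume `× k²`), and the dyadic pieces sum.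
[folklore] -/
theorem stub_hardLayerPDecay :
    (∀ (N : ℕ) (L : ℝ), 0 < L → ∀ V : Fin N → Fin N → ℝ → ℝ≥0∞, (∀ i j, V i j = V j i) →
      (∀ i j, Measurable (V i j)) →
      ∀ (η : UnitAddTorus (Fin N × Fin 3) → ℂ) (G H : Fin N × Fin 3 → UnitAddTorus (Fin N × Fin 3) → ℂ),
        (∀ q, G q =ᵐ[volume] η) → (∀ q, Measurable (H q)) →
        (∀ q : Fin N × Fin 3, ∀ᵐ t ∂(volume : Measure (UnitAddTorus (Fin N × Fin 3))),
        (∀ a b : ℝ, IntervalIntegrable (fun x : ℝ => H q (t + Pi.single q ((x : ℝ) : UnitAddCircle))) volume a b ∧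
          G q (t + Pi.single q ((b : ℝ) : UnitAddCircle)) - G q (t + Pi.single q ((a : ℝ) : UnitAddCircle)) =
            ∫ x in a..b, H q (t + Pi.single q ((x : ℝ) : UnitAddCircle))) ∧
        (∀ a b : ℝ, ∫⁻ x in Set.Ioo a b, pairInteraction V L
          (fromUnitTorusN L (t + Pi.single q ((x : ℝ) : UnitAddCircle))) *
            ‖G q (t + Pi.single q ((x : ℝ) : UnitAddCircle))‖ₑ ^ 2 ≠ ⊤)) →
        ∀ s : ℝ, 0 < s →
          ∫⁻ t in {t : UnitAddTorus (Fin N × Fin 3) | ∃ (i j : Fin N) (n : Fin 3 → ℤ), i ≠ j ∧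
              (hardRad (V i j)).Nonempty ∧
              0 < Metric.infDist (pairRad L (fromUnitTorusN L t) i j n) (hardRad (V i j)) ∧
              Metric.infDist (pairRad L (fromUnitTorusN L t) i j n) (hardRad (V i j)) ≤ 3 * s ∧
              40 * s ≤ pairRad L (fromUnitTorusN L t) i j n},
            ‖η t‖ₑ ^ 2 ≤
            ENNReal.ofReal (11 * s / L) * ENNReal.ofReal (22 * s / L) *
              ∑ q : Fin N × Fin 3, ∫⁻ t, (hardZoneP V L s).indicator (1 : Config N → ℝ≥0∞) (fromUnitTorusN L t) *
                ‖H q t‖ₑ ^ 2) →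
    (∀ (N : ℕ) (L : ℝ), 0 < L → ∀ V : Fin N → Fin N → ℝ → ℝ≥0∞, (∀ i j, V i j = V j i) →
      (∀ i j, Measurable (V i j)) →
      ∀ (η : UnitAddTorus (Fin N × Fin 3) → ℂ) (G H : Fin N × Fin 3 → UnitAddTorus (Fin N × Fin 3) → ℂ),
        (∀ q, G q =ᵐ[volume] η) →
        (∀ q : Fin N × Fin 3, ∀ᵐ t ∂(volume : Measure (UnitAddTorus (Fin N × Fin 3))),
        (∀ a b : ℝ, IntervalIntegrable (fun x : ℝ => H q (t + Pi.single q ((x : ℝ) : UnitAddCircle))) volume a b ∧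
          G q (t + Pi.single q ((b : ℝ) : UnitAddCircle)) - G q (t + Pi.single q ((a : ℝ) : UnitAddCircle)) =
            ∫ x in a..b, H q (t + Pi.single q ((x : ℝ) : UnitAddCircle))) ∧
        (∀ a b : ℝ, ∫⁻ x in Set.Ioo a b, pairInteraction V L
          (fromUnitTorusN L (t + Pi.single q ((x : ℝ) : UnitAddCircle))) *
            ‖G q (t + Pi.single q ((x : ℝ) : UnitAddCircle))‖ₑ ^ 2 ≠ ⊤)) →
        ∀ᵐ t ∂(volume : Measure (UnitAddTorus (Fin N × Fin 3))), fromUnitTorusN L t ∈ hardLayerP V L 0 → η t = 0) →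
    ∀ (N : ℕ) (L : ℝ), 0 < L → ∀ V : Fin N → Fin N → ℝ → ℝ≥0∞, (∀ i j, V i j = V j i) →
      (∀ i j, Measurable (V i j)) → ∀ R₀ : ℝ, (∀ i j, ∀ b ∈ hardRad (V i j), b ≤ R₀) →
      ∀ (η : UnitAddTorus (Fin N × Fin 3) → ℂ) (G H : Fin N × Fin 3 → UnitAddTorus (Fin N × Fin 3) → ℂ),
        (∀ q, G q =ᵐ[volume] η) → (∀ q, Measurable (H q)) → (∀ q, ∫⁻ t, ‖H q t‖ₑ ^ 2 ≠ ⊤) →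
        (∀ q : Fin N × Fin 3, ∀ᵐ t ∂(volume : Measure (UnitAddTorus (Fin N × Fin 3))),
        (∀ a b : ℝ, IntervalIntegrable (fun x : ℝ => H q (t + Pi.single q ((x : ℝ) : UnitAddCircle))) volume a b ∧
          G q (t + Pi.single q ((b : ℝ) : UnitAddCircle)) - G q (t + Pi.single q ((a : ℝ) : UnitAddCircle)) =
            ∫ x in a..b, H q (t + Pi.single q ((x : ℝ) : UnitAddCircle))) ∧
        (∀ a b : ℝ, ∫⁻ x in Set.Ioo a b, pairInteraction V L
          (fromUnitTorusN L (t + Pi.single q ((x : ℝ) : UnitAddCircle))) *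
            ‖G q (t + Pi.single q ((x : ℝ) : UnitAddCircle))‖ₑ ^ 2 ≠ ⊤)) →
        ∀ k : ℝ, (∀ᵐ t ∂(volume : Measure (UnitAddTorus (Fin N × Fin 3))), ‖η t‖ ≤ k) →
        ∀ ε : ℝ, 0 < ε → ∃ s₀ : ℝ, 0 < s₀ ∧ ∀ s : ℝ, 0 < s → s ≤ s₀ →
          ∫⁻ t in fromUnitTorusN L ⁻¹' hardLayerP V L s, ‖η t‖ₑ ^ 2 ≤ ENNReal.ofReal (ε * s ^ 2) := by
  intro hY hX N L hL V hVs hVm R₀ hSR η G H hGη hHm hHfin hgood k hηk ε hε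
  -- the zone energy and its smallness
  obtain ⟨Z, hZ⟩ : ∃ Z : ℝ → ℝ≥0∞, ∀ s, Z s = ∑ q : Fin N × Fin 3,
      ∫⁻ t, (hardZoneP V L s).indicator (1 : Config N → ℝ≥0∞) (fromUnitTorusN L t) * ‖H q t‖ₑ ^ 2 :=
    ⟨_, fun _ => rfl⟩
  have hZmono : ∀ {s s' : ℝ}, s ≤ s' → Z s ≤ Z s' := fun {s s'} h => by
    rw [hZ, hZ]
    refine Finset.sum_le_sum fun q _ => lintegral_mono fun t => ?_
    have hind : (hardZoneP V L s).indicator (1 : Config N → ℝ≥0∞) (fromUnitTorusN L t) ≤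
        (hardZoneP V L s').indicator (1 : Config N → ℝ≥0∞) (fromUnitTorusN L t) :=
      indicator_le_indicator_of_subset (hardZoneP_mono V L h) (fun _ => zero_le) _
    exact mul_le_mul_left hind _
  have hZlim : Tendsto (fun m : ℕ => Z (1 / ((m : ℝ) + 1))) atTop (𝓝 0) := by
    have h := tendsto_finsetSum (Finset.univ : Finset (Fin N × Fin 3)) fun q _ =>
      decayP_tendsto_zoneEnergy (V := V) hL hSR (F := fun t => ‖H q t‖ₑ ^ 2) (hHfin q)
    rw [Finset.sum_const_zero] at h
    refine h.congr fun m => ?_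
    rw [hZ]
    exact Finset.sum_congr rfl fun q _ =>
      (lintegral_indicator_preimage_mul (measurableSet_hardZoneP V L _) L _).symm
  have hδ₁ : (0 : ℝ≥0∞) < ENNReal.ofReal (ε * L ^ 2 / 484) := ENNReal.ofReal_pos.2 (by positivity)
  obtain ⟨m, hm⟩ := ((tendsto_order.1 hZlim).2 _ hδ₁).exists
  -- the scales
  set s₁ : ℝ := 1 / ((m : ℝ) + 1) with hs₁
  set K : ℝ := k ^ 2 * (N : ℝ) ^ 2 * 320 ^ 3 with hK
  have hK0 : 0 ≤ K := by positivity
  set s₂ : ℝ := ε * L ^ 3 / (2 * (K + 1)) with hs₂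
  have hs₂0 : 0 < s₂ := by positivity
  refine ⟨min (min s₁ s₂) (L / 80), lt_min (lt_min (by positivity) hs₂0) (by positivity), fun s hs hs0 => ?_⟩
  have hss₁ : s ≤ s₁ := hs0.trans ((min_le_left _ _).trans (min_le_left _ _))
  have hss₂ : s ≤ s₂ := hs0.trans ((min_le_left _ _).trans (min_le_right _ _))
  have hsL : s ≤ L / 80 := hs0.trans (min_le_right _ _)
  -- notation for the dyadic pieces
  set sj : ℕ → ℝ := fun j => s / 3 ^ (j + 1) with hsj
  have hsj0 : ∀ j, 0 < sj j := fun j => by positivity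
  have hsjs : ∀ j, sj j ≤ s := fun j => by
    rw [hsj]; dsimp only
    rw [div_le_iff₀ (by positivity)]
    exact le_mul_of_one_le_right hs.le (one_le_pow₀ (by norm_num))
  obtain ⟨A, hA⟩ : ∃ A : ℕ → Set (UnitAddTorus (Fin N × Fin 3)), ∀ j, A j = {t | ∃ (i j' : Fin N) (n : Fin 3 → ℤ),
      i ≠ j' ∧ (hardRad (V i j')).Nonempty ∧
      0 < Metric.infDist (pairRad L (fromUnitTorusN L t) i j' n) (hardRad (V i j')) ∧
      Metric.infDist (pairRad L (fromUnitTorusN L t) i j' n) (hardRad (V i j')) ≤ 3 * sj j ∧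
      40 * sj j ≤ pairRad L (fromUnitTorusN L t) i j' n} := ⟨_, fun _ => rfl⟩
  obtain ⟨B, hB⟩ : ∃ B : ℕ → Set (UnitAddTorus (Fin N × Fin 3)), ∀ j, B j = {t | ∃ (i j' : Fin N) (n : Fin 3 → ℤ),
      i ≠ j' ∧ pairRad L (fromUnitTorusN L t) i j' n < 40 * sj j} := ⟨_, fun _ => rfl⟩
  -- the `LayerA` pieces (hypothesis Y)
  have hAle : ∀ j, ∫⁻ t in A j, ‖η t‖ₑ ^ 2 ≤ ENNReal.ofReal (ε * sj j ^ 2 / 2) := by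
    intro j
    have h1 := hY N L hL V hVs hVm η G H hGη hHm hgood (sj j) (hsj0 j)
    rw [← hA j, ← hZ] at h1
    have h2 : Z (sj j) ≤ ENNReal.ofReal (ε * L ^ 2 / 484) := (hZmono ((hsjs j).trans hss₁)).trans hm.le
    calc ∫⁻ t in A j, ‖η t‖ₑ ^ 2 ≤ ENNReal.ofReal (11 * sj j / L) * ENNReal.ofReal (22 * sj j / L) * Z (sj j) := h1
      _ ≤ ENNReal.ofReal (11 * sj j / L) * ENNReal.ofReal (22 * sj j / L) * ENNReal.ofReal (ε * L ^ 2 / 484) := by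
          gcongr
      _ = ENNReal.ofReal (ε * sj j ^ 2 / 2) := by
          rw [← ENNReal.ofReal_mul (by positivity), ← ENNReal.ofReal_mul (by positivity)]
          congr 1
          field_simp
          ring
  -- the near-coincidence pieces
  have hη2 : ∀ᵐ t ∂(volume : Measure (UnitAddTorus (Fin N × Fin 3))), ‖η t‖ₑ ^ 2 ≤ ENNReal.ofReal (k ^ 2) := by
    filter_upwards [hηk] with t ht
    have hk0 : 0 ≤ k := (norm_nonneg _).trans ht
    rw [← ofReal_norm, ← ENNReal.ofReal_pow (norm_nonneg _)]
    exact ENNReal.ofReal_le_ofReal (pow_le_pow_left₀ (norm_nonneg _) ht 2)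
  have hBle : ∀ j, ∫⁻ t in B j, ‖η t‖ₑ ^ 2 ≤ ENNReal.ofReal (ε * sj j ^ 2 / 2) := by
    intro j
    have hr : 40 * sj j ≤ L / 2 := by linarith [hsjs j]
    have hvol := volume_exists_pairRad_lt_le (N := N) hL (by positivity : 0 < 40 * sj j) hr
    rw [← hB j] at hvol
    calc ∫⁻ t in B j, ‖η t‖ₑ ^ 2 ≤ ∫⁻ _t in B j, ENNReal.ofReal (k ^ 2) := lintegral_mono_ae (ae_restrict_of_ae hη2)
      _ = ENNReal.ofReal (k ^ 2) * volume (B j) := setLIntegral_const _ _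
      _ ≤ ENNReal.ofReal (k ^ 2) * ((N : ℝ≥0∞) ^ 2 * ENNReal.ofReal (8 * (40 * sj j) / L) ^ 3) := by gcongr
      _ = ENNReal.ofReal (K * sj j ^ 3 / L ^ 3) := by
          rw [← ENNReal.ofReal_natCast, ← ENNReal.ofReal_pow (Nat.cast_nonneg _), ← ENNReal.ofReal_pow (by positivity),
            ← ENNReal.ofReal_mul (by positivity), ← ENNReal.ofReal_mul (by positivity)]
          congr 1
          rw [hK]
          field_simp
          ring
      _ ≤ ENNReal.ofReal (ε * sj j ^ 2 / 2) := by
          refine ENNReal.ofReal_le_ofReal ?_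
          rw [div_le_iff₀ (by positivity)]
          have h1 : sj j ≤ s₂ := (hsjs j).trans hss₂
          have h2 : K * sj j ≤ K * s₂ := mul_le_mul_of_nonneg_left h1 hK0
          have h3 : K * s₂ ≤ ε * L ^ 3 / 2 := by
            rw [hs₂, mul_div_assoc', div_le_div_iff₀ (by positivity) (by positivity)]
            nlinarith [mul_pos hε (pow_pos hL 3)]
          have h4 : 0 ≤ sj j ^ 2 := sq_nonneg _
          nlinarith [mul_le_mul_of_nonneg_right (h2.trans h3) h4]
  -- each dyadic piece
  have hTle : ∀ j, ∫⁻ t in A j ∪ B j, ‖η t‖ₑ ^ 2 ≤ ENNReal.ofReal (ε * s ^ 2) * ((2 : ℝ≥0∞)⁻¹) ^ (j + 1) := by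
    intro j
    calc ∫⁻ t in A j ∪ B j, ‖η t‖ₑ ^ 2 ≤ (∫⁻ t in A j, ‖η t‖ₑ ^ 2) + ∫⁻ t in B j, ‖η t‖ₑ ^ 2 :=
          lintegral_union_le _ _ _
      _ ≤ ENNReal.ofReal (ε * sj j ^ 2 / 2) + ENNReal.ofReal (ε * sj j ^ 2 / 2) := add_le_add (hAle j) (hBle j)
      _ = ENNReal.ofReal (ε * (s / 3 ^ (j + 1)) ^ 2) := by
          rw [← ENNReal.ofReal_add (by positivity) (by positivity)]; congr 1; rw [hsj]; ring
      _ ≤ _ := ofReal_dyadic_le hε.le j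
  -- the hard configurations carry no mass (hypothesis X)
  have h0 : ∫⁻ t in fromUnitTorusN L ⁻¹' hardLayerP V L 0, ‖η t‖ₑ ^ 2 = 0 := by
    have hae := hX N L hL V hVs hVm η G H hGη hgood
    have hmeas : MeasurableSet (fromUnitTorusN L ⁻¹' hardLayerP V L 0) :=
      (measurableSet_hardLayerP V L 0).preimage (measurable_fromUnitTorusN L)
    refine (lintegral_congr_ae ((ae_restrict_iff' hmeas).2 (hae.mono fun t ht hmem => ?_))).trans lintegral_zero
    show ‖η t‖ₑ ^ 2 = 0
    rw [ht hmem]; simp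
  -- assemble
  calc ∫⁻ t in fromUnitTorusN L ⁻¹' hardLayerP V L s, ‖η t‖ₑ ^ 2
      ≤ ∫⁻ t in fromUnitTorusN L ⁻¹' hardLayerP V L 0 ∪ ⋃ j : ℕ, (A j ∪ B j), ‖η t‖ₑ ^ 2 := by
        refine lintegral_mono_set ((decayP_preimage_hardLayerP_subset V L hs).trans
          (union_subset_union_right _ (iUnion_mono fun j => ?_)))
        rw [hA j, hB j]
    _ ≤ (∫⁻ t in fromUnitTorusN L ⁻¹' hardLayerP V L 0, ‖η t‖ₑ ^ 2) +
          ∫⁻ t in ⋃ j : ℕ, (A j ∪ B j), ‖η t‖ₑ ^ 2 := lintegral_union_le _ _ _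
    _ ≤ 0 + ∑' j : ℕ, ∫⁻ t in A j ∪ B j, ‖η t‖ₑ ^ 2 := by rw [h0]; gcongr; exact lintegral_iUnion_le _ _
    _ ≤ 0 + ∑' j : ℕ, ENNReal.ofReal (ε * s ^ 2) * ((2 : ℝ≥0∞)⁻¹) ^ (j + 1) := by gcongr with j; exact hTle j
    _ = ENNReal.ofReal (ε * s ^ 2) := by rw [zero_add, ENNReal.tsum_mul_left, tsum_two_inv_pow_succ, mul_one]

end Summit.AtomisticToContinuum.BoseEinsteinCondensation.Cruxes.TorusHalfSwapOverlap.TruncationSplit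

end
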